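import Summits.Ventures.YMGap.Thresholds.OneLinkLawBiInvariance
import Mathlib.LinearAlgebra.Matrix.Permutation
import Mathlib.Data.Fin.Tuple.Sort
import HarnessLib

/-!
# Permutation symmetry of the one-link representatives: `diagonal(u·σ)` and `diagonal(u·(σ∘π))` carry the same statements (the sorted chamber)

HONEST FRAMING.  Exact identities for ONE tilted Haar law on `SU(N)` (explicit strong-coupling bookkeeping for lattice `SU(N)` Yang–Mills, small `β`);
certifies nothing; NOT weak coupling, NOT a continuum statement, NOT a Yang–Mills mass-gap claim.  Cell `pub-ymgap` (venture `YMGap`), seat engine-2 (g13).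
It completes the KERNEL form of lemma (L1) «orbit reduction to `e^{iφ}diag(s)`, `s₁ ≥ s₂ ≥ s₃`» of the cell `pub-balaban`'s C-iv certificate spec for
H2 = `OneLinkVarianceBound 3 (11/30) (49/20)` (`CERT-SPEC-sigma1-v2.md`): after `OneLinkLawBiInvariance` (SVD representatives) and `OneLinkLawConjugation`
(phase half), this file supplies the SORTING of the singular values.

THE ARGUMENT (folklore).  For a permutation `π` of `Fin N`, the permutation matrix `P_π` is unitary with `det P_π = sign π = ±1`; with an `N`-th root `ζ` of
`sign π`, `Q := ζ·P_π ∈ SU(N)` and `Q′ := ζ̄·P_{π⁻¹} ∈ SU(N)` (`smul_permMatrix_mem_specialUnitaryGroup`), and `Q · diagonal(d) · Q′ = diagonal(d ∘ π)` (the scalars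
cancel; `smul_perm_conj_diagonal`).  Hence by bi-invariance (`OneLinkBiInvariance.varianceBoundAt_conj` / `poincareAt_conj`) the H2-type bound and the H1-type
constant AT `diagonal(u·σ)` hold AT `diagonal(u·(σ∘π))` (★ `varianceBoundAt_diagonal_perm` / `poincareAt_diagonal_perm`), and a certificate may assume
`σ` MONOTONE (sorted): ★ `varianceLinAt_reps_of_sorted` / `poincareAt_reps_of_sorted` (Mathlib `Tuple.sort`).

References: standard linear algebra; the cell's CERT-SPEC (L1).
-/

noncomputable section

open scoped Matrix ComplexConjugate BigOperators
open Matrix Complex MeasureTheory ProbabilityTheory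
open Literature.MathematicalPhysics.QuantumFieldTheory
open Literature.MathematicalPhysics.QuantumFieldTheory.SUNBakryEmery
open Summit.Ventures.YMGap.OneLinkBiInvariance

namespace Summit.Ventures.YMGap.OneLinkPermutationSymmetry

variable {N : ℕ}

/-! ## 1. Phase-corrected permutation matrices in `SU(N)` -/

/-- There is `ζ ∈ ℂ` with `ζ^N = sign π` (`N ≥ 1`). [folklore] -/
theorem exists_root_sign (hN : 1 ≤ N) (π : Equiv.Perm (Fin N)) : ∃ ζ : ℂ, ζ ^ N = ((Equiv.Perm.sign π : ℤ) : ℂ) :=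
  IsAlgClosed.exists_pow_nat_eq _ (by omega)

/-- Such a `ζ` has norm one. [folklore] -/
theorem norm_eq_one_of_pow_eq_sign (hN : 1 ≤ N) {π : Equiv.Perm (Fin N)} {ζ : ℂ} (hζ : ζ ^ N = ((Equiv.Perm.sign π : ℤ) : ℂ)) : ‖ζ‖ = 1 := by
  have hs : ‖((Equiv.Perm.sign π : ℤ) : ℂ)‖ = 1 := by
    rcases Int.units_eq_one_or (Equiv.Perm.sign π) with h | h <;> simp [h]
  have h : ‖ζ‖ ^ N = 1 := by rw [← norm_pow, hζ, hs]
  exact (pow_eq_one_iff_of_nonneg (norm_nonneg ζ) (by omega)).1 h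

/-- `P_{π⁻¹} · P_π = 1`. [folklore] -/
theorem permMatrix_inv_mul (π : Equiv.Perm (Fin N)) :
    (π⁻¹).permMatrix ℂ * π.permMatrix ℂ = 1 := by
  rw [← Matrix.permMatrix_mul, mul_inv_cancel, Matrix.permMatrix_one]

/-- **`ζ·P_π ∈ SU(N)`** whenever `ζ^N = sign π`. [folklore] -/
theorem smul_permMatrix_mem_specialUnitaryGroup (hN : 1 ≤ N) (π : Equiv.Perm (Fin N)) {ζ : ℂ}
    (hζ : ζ ^ N = ((Equiv.Perm.sign π : ℤ) : ℂ)) :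
    ζ • π.permMatrix ℂ ∈ Matrix.specialUnitaryGroup (Fin N) ℂ := by
  have h1 : ‖ζ‖ = 1 := norm_eq_one_of_pow_eq_sign hN hζ
  have hzz : (starRingEnd ℂ) ζ * ζ = 1 := by
    rw [← Complex.normSq_eq_conj_mul_self, Complex.normSq_eq_norm_sq, h1]
    norm_num
  refine Matrix.mem_specialUnitaryGroup_iff.2 ⟨Matrix.mem_unitaryGroup_iff'.2 ?_, ?_⟩
  · rw [star_smul, Matrix.star_eq_conjTranspose, Matrix.conjTranspose_permMatrix, smul_mul_smul_comm, permMatrix_inv_mul,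
      Complex.star_def, hzz, one_smul]
  · have hs : ((Equiv.Perm.sign π : ℤ) : ℂ) * ((Equiv.Perm.sign π : ℤ) : ℂ) = 1 := by
      rcases Int.units_eq_one_or (Equiv.Perm.sign π) with h | h <;> simp [h]
    rw [Matrix.det_smul, Matrix.det_permutation, Fintype.card_fin, hζ, hs]

/-- The conjugate root belongs to the inverse permutation: `ζ̄^N = sign π⁻¹`. [folklore] -/
theorem conj_pow_eq_sign_inv {π : Equiv.Perm (Fin N)} {ζ : ℂ} (hζ : ζ ^ N = ((Equiv.Perm.sign π : ℤ) : ℂ)) :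
    (starRingEnd ℂ ζ) ^ N = ((Equiv.Perm.sign π⁻¹ : ℤ) : ℂ) := by
  rw [← map_pow, hζ, Equiv.Perm.sign_inv, map_intCast]

/-- **`(ζ P_π) · diagonal(d) · (ζ̄ P_{π⁻¹}) = diagonal(d ∘ π)`** for `‖ζ‖ = 1`. [folklore] -/
theorem smul_perm_conj_diagonal (π : Equiv.Perm (Fin N)) {ζ : ℂ} (h1 : ‖ζ‖ = 1) (d : Fin N → ℂ) :
    ζ • π.permMatrix ℂ * diagonal d * ((starRingEnd ℂ ζ) • (π⁻¹).permMatrix ℂ) = diagonal (d ∘ π) := by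
  have hzz : ζ * (starRingEnd ℂ) ζ = 1 := by
    rw [mul_comm, ← Complex.normSq_eq_conj_mul_self, Complex.normSq_eq_norm_sq, h1]
    norm_num
  rw [Matrix.smul_mul, Matrix.smul_mul, Matrix.mul_smul, smul_smul, hzz, one_smul]
  rw [Equiv.Perm.permMatrix, Equiv.Perm.permMatrix, PEquiv.toMatrix_toPEquiv_mul, Equiv.Perm.inv_def, PEquiv.mul_toMatrix_toPEquiv,
    Equiv.symm_symm, Matrix.submatrix_submatrix, Function.comp_id, Function.id_comp, Matrix.submatrix_diagonal_equiv]

/-! ## 2. ★ The statements at `diagonal(u·σ)` hold at `diagonal(u·(σ∘π))` -/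

/-- The permuted representative: `diagonal(u·σ) ∘ π = diagonal(u·(σ∘π))` (as functions `Fin N → ℂ`). [folklore] -/
theorem rep_comp_perm (u : ℂ) (σ : Fin N → ℝ) (π : Equiv.Perm (Fin N)) :
    ((fun i => u * ((σ i : ℝ) : ℂ)) ∘ π) = fun i => u * ((σ (π i) : ℝ) : ℂ) := rfl

/-- ★ **H2 AT `diagonal(u·σ)` ⇒ H2 AT `diagonal(u·(σ∘π))`** for every permutation `π` (`N ≥ 1`). [folklore] -/
theorem varianceBoundAt_diagonal_perm (hN : 1 ≤ N) (π : Equiv.Perm (Fin N)) {v : ℝ} {u : ℂ} {σ : Fin N → ℝ}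
    (h : ∀ Δ : Matrix (Fin N) (Fin N) ℂ,
      Var[fun g : SUN N => (N : ℝ) * ((g : Matrix (Fin N) (Fin N) ℂ) * Δ).trace.re ;
        (haarProbability (SUN N)).tilted fun g : SUN N =>
          (N : ℝ) * ((g : Matrix (Fin N) (Fin N) ℂ) * diagonal (fun i => u * ((σ i : ℝ) : ℂ))).trace.re] ≤ v * frobNorm Δ ^ 2)
    (Δ : Matrix (Fin N) (Fin N) ℂ) :
    Var[fun g : SUN N => (N : ℝ) * ((g : Matrix (Fin N) (Fin N) ℂ) * Δ).trace.re ;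
        (haarProbability (SUN N)).tilted fun g : SUN N =>
          (N : ℝ) * ((g : Matrix (Fin N) (Fin N) ℂ) * diagonal (fun i => u * ((σ (π i) : ℝ) : ℂ))).trace.re] ≤ v * frobNorm Δ ^ 2 := by
  obtain ⟨ζ, hζ⟩ := exists_root_sign hN π
  have key := varianceBoundAt_conj h ⟨_, smul_permMatrix_mem_specialUnitaryGroup hN π hζ⟩
    ⟨_, smul_permMatrix_mem_specialUnitaryGroup hN π⁻¹ (conj_pow_eq_sign_inv hζ)⟩ Δ
  rw [smul_perm_conj_diagonal π (norm_eq_one_of_pow_eq_sign hN hζ), rep_comp_perm] at key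
  exact key

/-- ★ **H1 AT `diagonal(u·σ)` ⇒ H1 AT `diagonal(u·(σ∘π))`** for every permutation `π` (`N ≥ 1`). [folklore] -/
theorem poincareAt_diagonal_perm (hN : 1 ≤ N) (π : Equiv.Perm (Fin N)) {c : ℝ} {u : ℂ} {σ : Fin N → ℝ}
    (h : ∀ (ψ : SUN N → ℝ) (M : ℝ), 0 ≤ M → (∀ a b : SUN N, |ψ a - ψ b| ≤ M * suFrobDist a b) →
      Var[ψ ; (haarProbability (SUN N)).tilted fun g : SUN N =>
        (N : ℝ) * ((g : Matrix (Fin N) (Fin N) ℂ) * diagonal (fun i => u * ((σ i : ℝ) : ℂ))).trace.re] ≤ c * M ^ 2)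
    (ψ : SUN N → ℝ) (M : ℝ) (hM : 0 ≤ M) (hψ : ∀ a b : SUN N, |ψ a - ψ b| ≤ M * suFrobDist a b) :
    Var[ψ ; (haarProbability (SUN N)).tilted fun g : SUN N =>
        (N : ℝ) * ((g : Matrix (Fin N) (Fin N) ℂ) * diagonal (fun i => u * ((σ (π i) : ℝ) : ℂ))).trace.re] ≤ c * M ^ 2 := by
  obtain ⟨ζ, hζ⟩ := exists_root_sign hN π
  have key := poincareAt_conj h ⟨_, smul_permMatrix_mem_specialUnitaryGroup hN π hζ⟩
    ⟨_, smul_permMatrix_mem_specialUnitaryGroup hN π⁻¹ (conj_pow_eq_sign_inv hζ)⟩ ψ M hM hψ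
  rw [smul_perm_conj_diagonal π (norm_eq_one_of_pow_eq_sign hN hζ), rep_comp_perm] at key
  exact key

/-! ## 3. ★ The sorted chamber suffices -/

/-- ★ **H2 at every representative from H2 at the SORTED representatives** (`σ` monotone, i.e. `σ₀ ≤ σ₁ ≤ … ≤ σ_{N−1}`): the conclusion is verbatim the
hypothesis of `OneLinkBiInvariance.oneLinkVarianceBound_of_reps`. [folklore] -/
theorem varianceLinAt_reps_of_sorted (hN : 1 ≤ N) {R v : ℝ}
    (h : ∀ (u : ℂ) (σ : Fin N → ℝ), ‖u‖ = 1 → (∀ i, 0 ≤ σ i) → (∀ i, σ i ≤ R) → Monotone σ → ∀ Δ : Matrix (Fin N) (Fin N) ℂ,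
      Var[fun g : SUN N => (N : ℝ) * ((g : Matrix (Fin N) (Fin N) ℂ) * Δ).trace.re ;
        (haarProbability (SUN N)).tilted fun g : SUN N =>
          (N : ℝ) * ((g : Matrix (Fin N) (Fin N) ℂ) * diagonal (fun i => u * ((σ i : ℝ) : ℂ))).trace.re] ≤ v * frobNorm Δ ^ 2)
    (u : ℂ) (σ : Fin N → ℝ) (hu : ‖u‖ = 1) (hσ0 : ∀ i, 0 ≤ σ i) (hσR : ∀ i, σ i ≤ R) (Δ : Matrix (Fin N) (Fin N) ℂ) :
    Var[fun g : SUN N => (N : ℝ) * ((g : Matrix (Fin N) (Fin N) ℂ) * Δ).trace.re ;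
        (haarProbability (SUN N)).tilted fun g : SUN N =>
          (N : ℝ) * ((g : Matrix (Fin N) (Fin N) ℂ) * diagonal (fun i => u * ((σ i : ℝ) : ℂ))).trace.re] ≤ v * frobNorm Δ ^ 2 := by
  set π := Tuple.sort σ with hπ
  have hsorted := h u (σ ∘ π) hu (fun i => hσ0 _) (fun i => hσR _) (Tuple.monotone_sort σ)
  have key := varianceBoundAt_diagonal_perm hN π⁻¹ hsorted Δ
  have hback : (fun i => u * (((σ ∘ π) (π⁻¹ i) : ℝ) : ℂ)) = fun i => u * ((σ i : ℝ) : ℂ) := by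
    funext i
    rw [Function.comp_apply, Equiv.Perm.inv_def, Equiv.apply_symm_apply]
  rw [hback] at key
  exact key

/-- ★ **H1 at every representative from H1 at the SORTED representatives** — conclusion verbatim the hypothesis of
`OneLinkBiInvariance.oneLinkPoincareSUN_of_reps`. [folklore] -/
theorem poincareAt_reps_of_sorted (hN : 1 ≤ N) {R c : ℝ}
    (h : ∀ (u : ℂ) (σ : Fin N → ℝ), ‖u‖ = 1 → (∀ i, 0 ≤ σ i) → (∀ i, σ i ≤ R) → Monotone σ →
      ∀ (ψ : SUN N → ℝ) (M : ℝ), 0 ≤ M → (∀ a b : SUN N, |ψ a - ψ b| ≤ M * suFrobDist a b) →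
        Var[ψ ; (haarProbability (SUN N)).tilted fun g : SUN N =>
          (N : ℝ) * ((g : Matrix (Fin N) (Fin N) ℂ) * diagonal (fun i => u * ((σ i : ℝ) : ℂ))).trace.re] ≤ c * M ^ 2)
    (u : ℂ) (σ : Fin N → ℝ) (hu : ‖u‖ = 1) (hσ0 : ∀ i, 0 ≤ σ i) (hσR : ∀ i, σ i ≤ R)
    (ψ : SUN N → ℝ) (M : ℝ) (hM : 0 ≤ M) (hψ : ∀ a b : SUN N, |ψ a - ψ b| ≤ M * suFrobDist a b) :
    Var[ψ ; (haarProbability (SUN N)).tilted fun g : SUN N =>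
        (N : ℝ) * ((g : Matrix (Fin N) (Fin N) ℂ) * diagonal (fun i => u * ((σ i : ℝ) : ℂ))).trace.re] ≤ c * M ^ 2 := by
  set π := Tuple.sort σ with hπ
  have hsorted := h u (σ ∘ π) hu (fun i => hσ0 _) (fun i => hσR _) (Tuple.monotone_sort σ)
  have key := poincareAt_diagonal_perm hN π⁻¹ hsorted ψ M hM hψ
  have hback : (fun i => u * (((σ ∘ π) (π⁻¹ i) : ℝ) : ℂ)) = fun i => u * ((σ i : ℝ) : ℂ) := by
    funext i
    rw [Function.comp_apply, Equiv.Perm.inv_def, Equiv.apply_symm_apply]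
  rw [hback] at key
  exact key

end Summit.Ventures.YMGap.OneLinkPermutationSymmetry

end
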